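import Mathlib
import Summits.Ventures.HodgeRepro.Tier4.Common.AdelicDefs
import Summits.Ventures.HodgeRepro.Tier4.Line1.RationalPoints
import Summits.Ventures.HodgeRepro.Tier4.Line1.LocallyCompactGA
import Summits.Ventures.HodgeRepro.Tier4.Line1.SecondCountableGA
import Summits.Ventures.HodgeRepro.Tier4.Line1.HaarFiniteOrder

/-!
# Tier4/Line1/QuadraticAdeleHaar — `𝔸_k[Ω]` on pairs, and Haar invariance under norm-one multiplication (F1)

Blind re-derivation cell `pub-hodge-repro`, Tier 4 (README §9–§10), seat t4-L1-p2 (prover, LINE L1, gen 0).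
Support for the cocompactness cut R-c of LINE L1 (t4-L1-p5's rung file `I1c-rungs-sig.lean`; p3's S12799 residual
(ii) of `hstab`, my S12847): FUJISAKI FOR THE NORM-ONE TORUS `{(x, y) ∈ 𝔸_k² : x² + d y² = 1}`, proved WITHOUT
absolute values, place decompositions or idele topologies.  `𝔸_k[Ω]` (`Ω² = −d`) is Mathlib's
`QuadraticAlgebra (𝔸_k) (−d) 0`; pairs `𝔸_k × 𝔸_k` carry the topology and the Haar measure, `equivProd` moves
between the two.  HC_CM is NOT proved by anyone in this repository.

CONTENT (module 1 of 3): the componentwise formulas for product, conjugation and norm of `𝔸_k[Ω]` on pairs,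
their continuity, and (F1) `map_mul_normOne_eq_self`: right multiplication by a norm-one element preserves every
Haar measure on `𝔸_k²` — because `w ↦ w z` is the composite of the two INVOLUTIONS `w ↦ w̄` and `w ↦ (w z)‾`
(involutive since `z z̄ = N(z) = 1`), and an involutive continuous automorphism preserves Haar measure
(`HaarFiniteOrder.map_eq_self_of_involutive`).  Modules 2–3: `PairBlichfeldt.lean`, `TorusFujisaki.lean`.
-/

set_option autoImplicit false

noncomputable section

namespace Summit.Ventures.HodgeRepro.Tier4.Line1

open NumberField MeasureTheory Measure Topology Common Set QuadraticAlgebra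
open scoped ENNReal NNReal

section QuadraticPairs

variable {k : Type} [Field k] [NumberField k] (d : k)

/-- the pair of an element of `𝔸_k[Ω]` (Mathlib's `QuadraticAlgebra (𝔸_k) (-d) 0`, `Ω² = −d`) -/
theorem equivProd_apply' (z : QuadraticAlgebra (Ad k) (-(algebraMap k (Ad k) d)) 0) :
    equivProd (-(algebraMap k (Ad k) d)) 0 z = (z.re, z.im) := rfl

/-- right multiplication by `z` on pairs, componentwise -/
theorem equivProd_symm_mul (p : Ad k × Ad k) (z : QuadraticAlgebra (Ad k) (-(algebraMap k (Ad k) d)) 0) :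
    equivProd (-(algebraMap k (Ad k) d)) 0 ((equivProd (-(algebraMap k (Ad k) d)) 0).symm p * z) =
      (p.1 * z.re - algebraMap k (Ad k) d * (p.2 * z.im), p.1 * z.im + p.2 * z.re) := by
  rw [equivProd_apply']
  simp only [re_mul, im_mul, equivProd_symm_apply, zero_mul, add_zero]
  refine Prod.ext ?_ ?_
  · show _ = _
    ring
  · rfl

/-- conjugation on pairs, componentwise -/
theorem equivProd_symm_star (p : Ad k × Ad k) :
    equivProd (-(algebraMap k (Ad k) d)) 0 (star ((equivProd (-(algebraMap k (Ad k) d)) 0).symm p)) =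
      (p.1, -p.2) := by
  rw [equivProd_apply']
  simp only [re_star, im_star, equivProd_symm_apply, zero_mul, add_zero]

/-- the norm of a pair -/
theorem norm_equivProd_symm (p : Ad k × Ad k) :
    norm ((equivProd (-(algebraMap k (Ad k) d)) 0).symm p) = p.1 * p.1 + algebraMap k (Ad k) d * (p.2 * p.2) := by
  rw [norm_def]
  simp only [equivProd_symm_apply]
  ring

/-- `equivProd` is additive -/
theorem equivProd_add (z w : QuadraticAlgebra (Ad k) (-(algebraMap k (Ad k) d)) 0) :
    equivProd (-(algebraMap k (Ad k) d)) 0 (z + w) =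
      equivProd (-(algebraMap k (Ad k) d)) 0 z + equivProd (-(algebraMap k (Ad k) d)) 0 w := by
  simp only [equivProd_apply', re_add, im_add, Prod.mk_add_mk]

/-- `equivProd.symm` is additive -/
theorem equivProd_symm_add (p q : Ad k × Ad k) :
    (equivProd (-(algebraMap k (Ad k) d)) 0).symm (p + q) =
      (equivProd (-(algebraMap k (Ad k) d)) 0).symm p + (equivProd (-(algebraMap k (Ad k) d)) 0).symm q := by
  rfl

/-- right multiplication by `z` on pairs is continuous -/
theorem continuous_equivProd_symm_mul (z : QuadraticAlgebra (Ad k) (-(algebraMap k (Ad k) d)) 0) :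
    Continuous fun p : Ad k × Ad k =>
      equivProd (-(algebraMap k (Ad k) d)) 0 ((equivProd (-(algebraMap k (Ad k) d)) 0).symm p * z) := by
  simp only [equivProd_symm_mul]
  exact ((continuous_fst.mul continuous_const).sub
    (continuous_const.mul (continuous_snd.mul continuous_const))).prodMk
    ((continuous_fst.mul continuous_const).add (continuous_snd.mul continuous_const))

/-- conjugation on pairs is continuous -/
theorem continuous_equivProd_symm_star :
    Continuous fun p : Ad k × Ad k =>
      equivProd (-(algebraMap k (Ad k) d)) 0 (star ((equivProd (-(algebraMap k (Ad k) d)) 0).symm p)) := by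
  simp only [equivProd_symm_star]
  exact continuous_fst.prodMk continuous_snd.neg

/-- the map `p ↦ p̄ z` (conjugation after right multiplication) is an involution when `N(z) = 1` -/
theorem star_mul_star_mul (z : QuadraticAlgebra (Ad k) (-(algebraMap k (Ad k) d)) 0) (hz : norm z = 1)
    (w : QuadraticAlgebra (Ad k) (-(algebraMap k (Ad k) d)) 0) :
    star (star (w * z) * z) = w := by
  rw [star_mul, star_star]
  have h : star z * (w * z) = w * (z * star z) := by ring
  rw [h, ← algebraMap_norm_eq_mul_star, hz, map_one, mul_one]

/-- the map `w ↦ w z` has inverse `w ↦ w z̄` when `N(z) = 1` -/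
theorem mul_mul_star (z : QuadraticAlgebra (Ad k) (-(algebraMap k (Ad k) d)) 0) (hz : norm z = 1)
    (w : QuadraticAlgebra (Ad k) (-(algebraMap k (Ad k) d)) 0) :
    w * z * star z = w := by
  rw [mul_assoc, ← algebraMap_norm_eq_mul_star, hz, map_one, mul_one]

end QuadraticPairs

section HaarInvariance

variable {k : Type} [Field k] [NumberField k] (d : k)

/-- **(F1) right multiplication by a norm-one element of `𝔸_k[Ω]` preserves every Haar measure on `𝔸_k²`**:
`w ↦ w z` is the composite of the two involutive continuous additive automorphisms `w ↦ w̄` and `w ↦ (w z)‾`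
(the latter involutive because `z z̄ = N(z) = 1`), and an involution preserves Haar measure
(`map_eq_self_of_involutive`).  No absolute value, no place decomposition. -/
theorem map_mul_normOne_eq_self [MeasurableSpace (Ad k × Ad k)] [BorelSpace (Ad k × Ad k)]
    (μ : Measure (Ad k × Ad k)) [μ.IsAddHaarMeasure]
    (z : QuadraticAlgebra (Ad k) (-(algebraMap k (Ad k) d)) 0) (hz : norm z = 1) :
    μ.map (fun p : Ad k × Ad k =>
      equivProd (-(algebraMap k (Ad k) d)) 0 ((equivProd (-(algebraMap k (Ad k) d)) 0).symm p * z)) = μ := by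
  haveI := locallyCompactSpace_adeleRing k
  haveI := secondCountable_adeleRing k
  -- the conjugation
  let c : (Ad k × Ad k) ≃ₜ+ (Ad k × Ad k) :=
    { toFun := fun p => equivProd (-(algebraMap k (Ad k) d)) 0 (star ((equivProd (-(algebraMap k (Ad k) d)) 0).symm p))
      invFun := fun p => equivProd (-(algebraMap k (Ad k) d)) 0 (star ((equivProd (-(algebraMap k (Ad k) d)) 0).symm p))
      left_inv := fun p => by simp only [Equiv.symm_apply_apply, star_star, Equiv.apply_symm_apply]
      right_inv := fun p => by simp only [Equiv.symm_apply_apply, star_star, Equiv.apply_symm_apply]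
      map_add' := fun p q => by
        simp only [equivProd_symm_add, star_add, equivProd_add]
      continuous_toFun := continuous_equivProd_symm_star d
      continuous_invFun := continuous_equivProd_symm_star d }
  -- the involution `p ↦ (p z)‾`
  let φ : (Ad k × Ad k) ≃ₜ+ (Ad k × Ad k) :=
    { toFun := fun p => equivProd (-(algebraMap k (Ad k) d)) 0 (star ((equivProd (-(algebraMap k (Ad k) d)) 0).symm p * z))
      invFun := fun p => equivProd (-(algebraMap k (Ad k) d)) 0 (star ((equivProd (-(algebraMap k (Ad k) d)) 0).symm p * z))
      left_inv := fun p => by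
        simp only [Equiv.symm_apply_apply]
        rw [star_mul_star_mul d z hz, Equiv.apply_symm_apply]
      right_inv := fun p => by
        simp only [Equiv.symm_apply_apply]
        rw [star_mul_star_mul d z hz, Equiv.apply_symm_apply]
      map_add' := fun p q => by
        simp only [equivProd_symm_add, add_mul, star_add, equivProd_add]
      continuous_toFun := (continuous_equivProd_symm_star d).comp (continuous_equivProd_symm_mul d z)
      continuous_invFun := (continuous_equivProd_symm_star d).comp (continuous_equivProd_symm_mul d z) }
  have hc : μ.map c = μ := map_eq_self_of_involutive μ c (fun p => by
    show equivProd _ _ (star ((equivProd _ _).symm (equivProd _ _ (star ((equivProd _ _).symm p))))) = p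
    simp only [Equiv.symm_apply_apply, star_star, Equiv.apply_symm_apply])
  have hφ : μ.map φ = μ := map_eq_self_of_involutive μ φ (fun p => by
    show equivProd _ _ (star ((equivProd _ _).symm (equivProd _ _ (star ((equivProd _ _).symm p * z))) * z)) = p
    simp only [Equiv.symm_apply_apply]
    rw [star_mul_star_mul d z hz, Equiv.apply_symm_apply])
  -- `w ↦ w z` is `c ∘ φ`
  have hcomp : (fun p : Ad k × Ad k =>
      equivProd (-(algebraMap k (Ad k) d)) 0 ((equivProd (-(algebraMap k (Ad k) d)) 0).symm p * z)) =
      (c : (Ad k × Ad k) → (Ad k × Ad k)) ∘ (φ : (Ad k × Ad k) → (Ad k × Ad k)) := by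
    funext p
    show _ = equivProd _ _ (star ((equivProd _ _).symm (equivProd _ _ (star ((equivProd _ _).symm p * z)))))
    simp only [Equiv.symm_apply_apply, star_star]
  have hcm : Measurable (c : Ad k × Ad k → Ad k × Ad k) := by exact c.continuous.measurable
  have hφm : Measurable (φ : Ad k × Ad k → Ad k × Ad k) := by exact φ.continuous.measurable
  rw [hcomp, ← Measure.map_map hcm hφm, hφ, hc]

/-- the image form of (F1): `μ (S z) = μ S` for every `S ⊆ 𝔸_k²` and norm-one `z` -/
theorem measure_image_mul_normOne [MeasurableSpace (Ad k × Ad k)] [BorelSpace (Ad k × Ad k)]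
    (μ : Measure (Ad k × Ad k)) [μ.IsAddHaarMeasure]
    (z : QuadraticAlgebra (Ad k) (-(algebraMap k (Ad k) d)) 0) (hz : norm z = 1) (S : Set (Ad k × Ad k)) :
    μ ((fun p : Ad k × Ad k =>
      equivProd (-(algebraMap k (Ad k) d)) 0 ((equivProd (-(algebraMap k (Ad k) d)) 0).symm p * z)) '' S) = μ S := by
  haveI := locallyCompactSpace_adeleRing k
  haveI := secondCountable_adeleRing k
  let e : (Ad k × Ad k) ≃ₜ+ (Ad k × Ad k) :=
    { toFun := fun p => equivProd (-(algebraMap k (Ad k) d)) 0 ((equivProd (-(algebraMap k (Ad k) d)) 0).symm p * z)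
      invFun := fun p => equivProd (-(algebraMap k (Ad k) d)) 0 ((equivProd (-(algebraMap k (Ad k) d)) 0).symm p * star z)
      left_inv := fun p => by
        simp only [Equiv.symm_apply_apply]
        rw [mul_mul_star d z hz, Equiv.apply_symm_apply]
      right_inv := fun p => by
        simp only [Equiv.symm_apply_apply]
        rw [mul_assoc, mul_comm (star z) z, ← algebraMap_norm_eq_mul_star, hz, map_one, mul_one,
          Equiv.apply_symm_apply]
      map_add' := fun p q => by
        simp only [equivProd_symm_add, add_mul, equivProd_add]
      continuous_toFun := continuous_equivProd_symm_mul d z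
      continuous_invFun := continuous_equivProd_symm_mul d (star z) }
  exact measure_image_eq_of_map_eq μ e (map_mul_normOne_eq_self d μ z hz) S

end HaarInvariance

end Summit.Ventures.HodgeRepro.Tier4.Line1

end
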